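import Summits.HodgeConjecture.CorCM.OcticWeilMixedHodgeOfMarkman
import Summits.HodgeConjecture.CorCM.OcticWeilOrbitMumfordExample
import HarnessLib

/-!
# COR-CM — MIXED products `E × B₁ × B₂ × B'`: NON-VACUITY (Mumford's fourfold, a conjugate `(2,2)`-type, a `(1,3)`-type of
# `F(i)` and the CM curve of `ℚ(i)` inhabit every hypothesis)

Cell `pub-hodgecm2` (COR-CM), seat b30 gen 20 (2026-08-22); count-neutral own lane OCTIC-WEIL-ORBIT, part MIXED.  Theorems
only; no definition, no named fact of its own, no `sorry`.

`exists_hypotheses_octicWeilMixed`: the hypotheses of `OcticWeilMixed.hodgeConjectureFor_biproduct_comp_vec_of_isSimple_of_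
markmanM` are INHABITED — Mumford–Pohlmann's octic CM field `K = F(i) ⊃ ℚ(i)`, `Φ₁ = Φ_P` (`|P| = 2`, SIMPLE realisation), the
second star type `Φ₂` and a `(1,3)`-type `Φ'_c` read through a frame of `Φ₁` (`exists_cmType_of_frame`,
`exists_cmType13_of_frame`), all realised by the tree's `cmAbelianVarietyRealised_holds`, and a CM elliptic curve of `ℚ(i)`;
`hodgeConjectureFor_mumfordMixed_of_markman`: hence Markman's two theorems give the Hodge conjecture for every product of
copies of these four varieties.  HONEST FRAMING: conditional on the two displayed Markman binders; `HC_CM` is not asserted.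

## References
* [Pohlmann1968] H. Pohlmann, Ann. of Math. 88 (1968), §3.  [vanGeemen1994HodgeAV] Thm. 4.5, 4.7.  [Shimura1998] §6.2 Thm. 3,
  §8.2 Prop. 26.  [Markman2025SurveySecant] arXiv:2509.23403, Thm. 1.2.  [Markman2025SecantWeil] arXiv:2502.03415, Thm 1.5.1.
-/

noncomputable section

open CategoryTheory CategoryTheory.Limits NumberField

namespace Summit.HodgeConjecture.CorCM.OcticWeilMixed.MumfordExample

open Literature.AlgebraicGeometry Literature.AlgebraicGeometry.Motives Literature.AlgebraicGeometry.HodgeTheory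
open Literature.AlgebraicGeometry.ComplexMultiplication (IsCMTypeRealisation)
open Literature.AlgebraicTopology.SingularHomology
open Literature.AlgebraicGeometry.Pohlmann1968.MumfordFourfold (K Qi j weilType finrank_K isSimple_and_exists_exceptional)
open Literature.NumberTheory.NumberFields.MumfordQuartic (F)
open Literature.NumberTheory.ComplexMultiplication (CMTypeCount.single CMTypeCount.single_val)
open Summit.HodgeConjecture.CorCM.Census.OcticWeilOrbit (signTab permTab_facts)
open Summit.HodgeConjecture.CorCM.Census.OcticWeilMixed (signTabM signTabM_two)
open Summit.HodgeConjecture.CorCM.OcticWeilOrbit (card_filter_symm_true exists_cmType_of_frame counts_of_frame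
  inr_mem_phi₂_iff_signTab)
open Summit.HodgeConjecture.CorCM.OcticWeilFourfold (exists_frame₂)
open Summit.HodgeConjecture.CorCM.OcticWeilFourfold.MumfordExample (finrank_Qi isCMField_Qi card_filter_comp_j_eq_two)

open scoped Classical

/-! ## §1 A frame-read `(1,3)`-type and its count -/

variable {L : Type} [Field L]

/-- **A frame-read `(1,3)`-type**: for a frame `e` with `e s̄ = ((e s).1, ¬(e s).2)` and `c < 4`, the set
`{s | (e s).2 = [(e s).1 = c]}` is a CM type (exactly one of `s, s̄`). [cite: Deligne1982HodgeCycles, §5 (S = Φ ⊔ ιΦ)] -/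
theorem exists_cmType13_of_frame {e : (L →+* ℂ) ≃ Fin 4 × Bool}
    (he_conj : ∀ s, e (ComplexEmbedding.conjugate s) = ((e s).1, !(e s).2)) (c : Fin 4) :
    ∃ Φ : CMType L, ∀ s, s ∈ Φ.1 ↔ (e s).2 = signTabM c 0 2 (e s).1 :=
  ⟨⟨{s | (e s).2 = signTabM c 0 2 (e s).1}, fun s => by
    simp only [Set.mem_setOf_eq, he_conj]
    cases (e s).2 <;> cases signTabM c 0 2 (e s).1 <;> decide⟩, fun _ => Iff.rfl⟩

variable {l : Type} [Field l] [Fintype (L →+* ℂ)] {e : (L →+* ℂ) ≃ Fin 4 × Bool} {i : l →+* L} {τ : l →+* ℂ}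

/-- The count of a frame-read `(1,3)`-type over `τ`: `#{s | s ∘ i = τ ∧ s ∈ Φ'_c} = 1`. [folklore] -/
theorem count_of_frame13 (he_sign : ∀ s, (e s).2 = true ↔ s.comp i = τ) {c : Fin 4} {Φ : CMType L}
    (hΦ : ∀ s, s ∈ Φ.1 ↔ (e s).2 = signTabM c 0 2 (e s).1) :
    (Finset.univ.filter fun s : L →+* ℂ => s.comp i = τ ∧ s ∈ Φ.1).card = 1 := by
  have hread : ∀ a : Fin 4, e.symm (a, true) ∈ Φ.1 ↔ a = c := fun a => by
    rw [hΦ, Equiv.apply_symm_apply, signTabM_two, permTab_facts.2.2]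
    change true = decide (a = c) ↔ a = c
    by_cases h : a = c
    · rw [decide_eq_true h]; simp [h]
    · rw [decide_eq_false h]; simp [h]
  rw [← card_filter_symm_true he_sign (fun s => s ∈ Φ.1), Finset.card_eq_one]
  exact ⟨c, by ext a; simp [Finset.mem_filter, hread a]⟩

/-! ## §2 The hypotheses of the mixed theorem are inhabited; Mumford's mixed products -/

/-- **NON-VACUITY (mixed).**  There exist an octic CM field `K`, an imaginary quadratic CM field `k`, `i : k → K`,
`τ : k → ℂ`, CM types `Φ₁, Φ₂` (`k`-signature `(2,2)`, general position; `Φ₁` with a SIMPLE realisation `B₁`), `Φ'`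
(`k`-signature `(1,3)`) with realisations, and a CM elliptic curve `E ⊨ (k; Ψ ∋ τ)` — Mumford's `F(i) ⊃ ℚ(i)`, `Φ₁ = Φ_P`,
`Φ₂`, `Φ'` read through a frame of `Φ₁`, all realised by `cmAbelianVarietyRealised_holds`. [cite: Pohlmann1968, §3]
[cite: vanGeemen1994HodgeAV, Thm. 4.5] [cite: Shimura1998, §6.2 Thm. 3] -/
theorem exists_hypotheses_octicWeilMixed :
    ∃ (K k : Type) (_ : Field K) (_ : NumberField K) (_ : IsCMField K) (_ : Field k) (_ : NumberField k) (_ : IsCMField k)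
      (i : k →+* K) (τ : k →+* ℂ) (Φ₁ Φ₂ Φ' : CMType K) (B₁ B₂ B' : AbelianVariety ℂ)
      (ι₁ : 𝓞 K →+* End B₁) (θ₁ : K →+* Module.End ℂ (complexBetti B₁.X 1))
      (ι₂ : 𝓞 K →+* End B₂) (θ₂ : K →+* Module.End ℂ (complexBetti B₂.X 1))
      (ι' : 𝓞 K →+* End B') (θ' : K →+* Module.End ℂ (complexBetti B'.X 1))
      (Ψ : CMType k) (E : AbelianVariety ℂ) (ιE : 𝓞 k →+* End E) (θE : k →+* Module.End ℂ (complexBetti E.X 1)),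
      Module.finrank ℚ K = 8 ∧ Module.finrank ℚ k = 2 ∧
      IsCMTypeRealisation Φ₁ B₁ ι₁ θ₁ ∧ B₁.IsSimple ∧ IsCMTypeRealisation Φ₂ B₂ ι₂ θ₂ ∧ IsCMTypeRealisation Φ' B' ι' θ' ∧
      IsCMTypeRealisation Ψ E ιE θE ∧ τ ∈ Ψ.1 ∧
      (Finset.univ.filter fun s : K →+* ℂ => s.comp i = τ ∧ s ∈ Φ₁.1).card = 2 ∧
      (Finset.univ.filter fun s : K →+* ℂ => s.comp i = τ ∧ s ∈ Φ₂.1).card = 2 ∧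
      (Finset.univ.filter fun s : K →+* ℂ => s.comp i = τ ∧ (s ∈ Φ₁.1 ∧ s ∈ Φ₂.1)).card = 1 ∧
      (Finset.univ.filter fun s : K →+* ℂ => s.comp i = τ ∧ s ∈ Φ'.1).card = 1 := by
  haveI : IsCMField Qi := isCMField_Qi
  obtain ⟨P, -, hP⟩ := Finset.exists_subset_card_eq (s := (Finset.univ : Finset (F →+* ℂ))) (n := 2)
    (by rw [Finset.card_univ, Literature.NumberTheory.NumberFields.MumfordQuartic.card_embeddings]; norm_num)
  obtain ⟨B₁, ι₁, θ₁, hB₁⟩ := cmAbelianVarietyRealised_holds K (weilType P)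
  obtain ⟨τ⟩ : Nonempty (Qi →+* ℂ) := inferInstance
  obtain ⟨E, ιE, θE, hE⟩ := cmAbelianVarietyRealised_holds Qi (CMTypeCount.single finrank_Qi τ)
  have hττ : ComplexEmbedding.conjugate τ ≠ τ := QuarticCM.conjugate_ne τ
  have hk : ∀ σ : Qi →+* ℂ, σ = τ ∨ σ = ComplexEmbedding.conjugate τ := fun σ =>
    QuarticCM.eq_or_eq_conjugate_of_quadratic finrank_Qi τ σ
  obtain ⟨e, he_sign, he_conj, hΦP⟩ := exists_frame₂ finrank_K finrank_Qi j hττ hk (weilType P)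
    (card_filter_comp_j_eq_two hP τ)
  have hr₁ : ∀ s, s ∈ (weilType P).1 ↔ (e s).2 = signTab 0 0 (e s).1 := fun s => by
    rw [hΦP s, inr_mem_phi₂_iff_signTab]
  obtain ⟨Φ₂, hr₂⟩ := exists_cmType_of_frame he_conj 1
  obtain ⟨Φ', hr'⟩ := exists_cmType13_of_frame he_conj 0
  obtain ⟨B₂, ι₂, θ₂, hB₂⟩ := cmAbelianVarietyRealised_holds K Φ₂
  obtain ⟨B', ι', θ', hB'⟩ := cmAbelianVarietyRealised_holds K Φ'
  obtain ⟨h22₁, h₁₂⟩ := counts_of_frame he_sign (show (0 : Fin 3) ≠ 1 by decide) hr₁ hr₂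
  obtain ⟨h22₂, -⟩ := counts_of_frame he_sign (show (1 : Fin 3) ≠ 0 by decide) hr₂ hr₁
  exact ⟨K, Qi, inferInstance, inferInstance, inferInstance, inferInstance, inferInstance, inferInstance, j, τ, weilType P,
    Φ₂, Φ', B₁, B₂, B', ι₁, θ₁, ι₂, θ₂, ι', θ', CMTypeCount.single finrank_Qi τ, E, ιE, θE, finrank_K, finrank_Qi, hB₁,
    (isSimple_and_exists_exceptional hP hB₁).1, hB₂, hB', hE, by rw [CMTypeCount.single_val]; rfl, h22₁, h22₂, h₁₂,
    count_of_frame13 he_sign hr'⟩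

/-- **MUMFORD'S MIXED PRODUCTS: the Hodge conjecture for every product of copies of `E, B₁, B₂, B'`, GIVEN ONLY Markman's two
theorems**, where `B₁ ⊨ (F(i); Φ_P)` (`|P| = 2`, simple), `B₂` realises the second star type and `B'` a `(1,3)`-type through a
frame `e` of `Φ_P` over `(j, τ)`, and `E` is a CM elliptic curve of `ℚ(i)`. [cite: Markman2025SurveySecant, Thm. 1.2]
[cite: Markman2025SecantWeil, Thm 1.5.1] [cite: Pohlmann1968, §3] -/
theorem hodgeConjectureFor_mumfordMixed_of_markman (hW4 : Markman2025_weilClasses_algebraic_abelianFourfold)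
    (hM6 : Markman2025_weilClasses_algebraic_hyperbolicSixfold)
    {N : ℕ} {P : Finset (F →+* ℂ)} (hP : P.card = 2) {τ : Qi →+* ℂ} {e : (K →+* ℂ) ≃ Fin 4 × Bool}
    (he_sign : ∀ s, (e s).2 = true ↔ s.comp j = τ) {c : Fin 4}
    {Φ₂ Φ' : CMType K} (hr₁ : ∀ s, s ∈ (weilType P).1 ↔ (e s).2 = signTab 0 0 (e s).1)
    (hr₂ : ∀ s, s ∈ Φ₂.1 ↔ (e s).2 = signTab 0 1 (e s).1) (hr' : ∀ s, s ∈ Φ'.1 ↔ (e s).2 = signTabM c 0 2 (e s).1)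
    {B₁ B₂ B' : AbelianVariety ℂ} {ι₁ : 𝓞 K →+* End B₁} {θ₁ : K →+* Module.End ℂ (complexBetti B₁.X 1)}
    {ι₂ : 𝓞 K →+* End B₂} {θ₂ : K →+* Module.End ℂ (complexBetti B₂.X 1)}
    {ι' : 𝓞 K →+* End B'} {θ' : K →+* Module.End ℂ (complexBetti B'.X 1)}
    (hB₁ : IsCMTypeRealisation (weilType P) B₁ ι₁ θ₁) (hB₂ : IsCMTypeRealisation Φ₂ B₂ ι₂ θ₂)
    (hB' : IsCMTypeRealisation Φ' B' ι' θ')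
    {Ψ : CMType Qi} {E : AbelianVariety ℂ} {ιE : 𝓞 Qi →+* End E} {θE : Qi →+* Module.End ℂ (complexBetti E.X 1)}
    (hE : IsCMTypeRealisation Ψ E ιE θE) (hτΨ : τ ∈ Ψ.1) (κ : Fin N → Fin 4) :
    HodgeConjectureFor (⨁ fun m => (![E, B₁, B₂, B'] : Fin 4 → AbelianVariety ℂ) (κ m)).dim
      (⨁ fun m => (![E, B₁, B₂, B'] : Fin 4 → AbelianVariety ℂ) (κ m)).X := by
  haveI : IsCMField Qi := isCMField_Qi
  obtain ⟨h22₁, h₁₂⟩ := counts_of_frame he_sign (show (0 : Fin 3) ≠ 1 by decide) hr₁ hr₂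
  obtain ⟨h22₂, -⟩ := counts_of_frame he_sign (show (1 : Fin 3) ≠ 0 by decide) hr₂ hr₁
  exact hodgeConjectureFor_biproduct_comp_vec_of_isSimple_of_markmanM hW4 hM6 finrank_K finrank_Qi j hB₁
    (isSimple_and_exists_exceptional hP hB₁).1 hB₂ hB' hE hτΨ h22₁ h22₂ h₁₂ (count_of_frame13 he_sign hr') κ

end Summit.HodgeConjecture.CorCM.OcticWeilMixed.MumfordExample

end
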